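import Summits.MatrixMultiplication.MatrixMultiplication.Theorems.SoloBlindCorankTwoKraft

/-!
# Conjecture E at corank two: the star case

Sub-programme (K₃) / Conjecture E.  Setting of `SoloBlindCorankTwoKraft`: `G` of exponent `3`, `B` sum-distinct
for `h`, `p ≠ q` outside `B`, `h` zero-sum free on `S = B ∪ {p, q}`.  CONJECTURE E asks `E(τ; S) ≤ 1/2` for
H-good `τ`; by H-goodness the representations of `τ` pairwise intersect, and the first structural case is the
STAR: all representations of `τ` pass through one index `x ∈ S`.

* `soloBlind_conjE_corank_two_star` — in the star case `E(τ; S) ≤ 1/2` (no H-goodness needed beyond the star):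
  by the cone identity (`soloBlind_mass_cone`) `E(τ; S) = K(τ - h x; S \ x) / 2`, and `S \ x` is again
  'sum-distinct plus at most two elements' (`x = p`, `x = q`, or `x ∈ B` with `B \ x` sum-distinct), so the
  corank-one / corank-two Kraft inequalities (`soloBlind_kraft_corank_one`, `soloBlind_kraft_corank_two`) bound
  the cone mass by `1`.

What remains of Conjecture E at corank two is the non-star case (three or four representations among
`A₀, A₁ ∪ {p}, A₂ ∪ {q}, A₃ ∪ {p, q}` without a common index), settled numerically by the type search (K3.29,
family of `1 830` supports) and left for a later kernel file.
-/

namespace Summit.MatrixMultiplication.MatrixMultiplication.Theorems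

open Finset

universe u

variable {ι : Type*} [DecidableEq ι]
variable {G : Type u} [AddCommGroup G] [DecidableEq G]

omit [DecidableEq ι] [DecidableEq G] in
/-- Sum-distinctness is inherited by subsets. -/
theorem soloBlind_sumDistinct_mono {h : ι → G} {B B' : Finset ι} (hB' : B' ⊆ B)
    (hdist : ∀ A ⊆ B, ∀ A' ⊆ B, ∑ i ∈ A, h i = ∑ i ∈ A', h i → A = A') :
    ∀ A ⊆ B', ∀ A' ⊆ B', ∑ i ∈ A, h i = ∑ i ∈ A', h i → A = A' :=
  fun A hA A' hA' e => hdist A (hA.trans hB') A' (hA'.trans hB') e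

/-- CONJECTURE E AT CORANK TWO, STAR CASE: if every representation of `τ` in `S = B ∪ {p, q}` contains a fixed
index `x ∈ S`, then `E(τ; S) ≤ 1/2`. -/
theorem soloBlind_conjE_corank_two_star (three : ∀ g : G, g + g + g = 0) {h : ι → G} {B : Finset ι}
    {p q : ι} (hpB : p ∉ B) (hqB : q ∉ B) (hpq : p ≠ q)
    (hdist : ∀ A ⊆ B, ∀ A' ⊆ B, ∑ i ∈ A, h i = ∑ i ∈ A', h i → A = A')
    (zsf : ∀ T ⊆ insert q (insert p B), T.Nonempty → ∑ i ∈ T, h i ≠ 0) {τ : G} {x : ι}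
    (hx : x ∈ insert q (insert p B)) (hstar : ∀ T ∈ soloBlindSeqRepAll h (insert q (insert p B)) τ, x ∈ T) :
    soloBlindMass h (insert q (insert p B)) τ ≤ 1 / 2 := by
  rw [soloBlind_mass_cone h hx τ hstar]
  have zsf' : ∀ T ⊆ (insert q (insert p B)).erase x, T.Nonempty → ∑ i ∈ T, h i ≠ 0 :=
    fun T hT hne => zsf T (hT.trans (Finset.erase_subset x _)) hne
  suffices hK : soloBlindMass h ((insert q (insert p B)).erase x) (τ - h x) ≤ 1 by linarith
  have hq' : q ∉ insert p B := by
    intro hq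
    rcases Finset.mem_insert.mp hq with hq | hq
    · exact hpq hq.symm
    · exact hqB hq
  rcases Finset.mem_insert.mp hx with rfl | hx'
  · -- `x = q`: `S \ q = B ∪ {p}`, corank one
    rw [Finset.erase_insert hq'] at zsf' ⊢
    exact soloBlind_kraft_corank_one hpB hdist zsf' (τ - h x)
  · rcases Finset.mem_insert.mp hx' with rfl | hxB
    · -- `x = p`: `S \ p = B ∪ {q}`, corank one
      have e : (insert q (insert x B)).erase x = insert q B := by
        rw [Finset.erase_insert_of_ne (Ne.symm hpq), Finset.erase_insert hpB]
      rw [e] at zsf' ⊢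
      exact soloBlind_kraft_corank_one hqB hdist zsf' (τ - h x)
    · -- `x ∈ B`: `S \ x = (B \ x) ∪ {p, q}`, corank two over the sum-distinct `B \ x`
      have hxp : x ≠ p := fun e => hpB (e ▸ hxB)
      have hxq : x ≠ q := fun e => hqB (e ▸ hxB)
      have e : (insert q (insert p B)).erase x = insert q (insert p (B.erase x)) := by
        rw [Finset.erase_insert_of_ne hxq.symm, Finset.erase_insert_of_ne hxp.symm]
      rw [e] at zsf' ⊢
      have hpB' : p ∉ B.erase x := fun hp => hpB (Finset.mem_of_mem_erase hp)
      have hqB' : q ∉ B.erase x := fun hq => hqB (Finset.mem_of_mem_erase hq)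
      exact soloBlind_kraft_corank_two three hpB' hqB' hpq
        (soloBlind_sumDistinct_mono (Finset.erase_subset x B) hdist) zsf' (τ - h x)

end Summit.MatrixMultiplication.MatrixMultiplication.Theorems
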